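import Summits.CriticalPhenomena.CardyFormulaZ2.Theorems.CardyUniqueLimitCardyRigidityLoewnerKit
import Literature.Probability.RandomPlanarGeometry.LoewnerRealKoebe
import Literature.Probability.RandomPlanarGeometry.LoewnerGrowth
import HarnessLib

/-!
# Loewner–Carathéodory convergence kit, V: the real footprint of the hull and its image under `g_t`

Crux `Summit.CriticalPhenomena.CardyFormulaZ2.Theses.CardyUniqueLimit.CardyRigidity`
(stmt-CriticalPhenomena-0746), line `crossing_martingale`, helper kit for the registered stub A3b
`stub_slitObservableApprox`; sequel of kits I–IV.  Bookkeeping of the REAL BOUNDARY of the slit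
half-plane `ℍ ∖ K_t` seen through `g_t = Loewner.map W t` (L3, "boundary points off the hull"):
the real points alive at time `t` to the right of the driving point,
`R_t = {x | W 0 < x, t < T_x}`, form a nonempty open up-ray on which `x ↦ g_t(x)` is real,
continuous, strictly increasing, `≥ x`, hence maps `R_t` onto the open ray `(a⁺_t, ∞)` where

    a⁺_t = sInf (g_t '' R_t) ≥ W_t

is the RIGHT END OF THE IMAGE OF THE HULL (the image of the hull boundary together with the
swallowed segment is `[a⁻_t, a⁺_t] ∋ W_t`); symmetrically on the left with
`L_t = {x | x < W 0, t < T_x}`, `a⁻_t = sSup (g_t '' L_t) ≤ W_t`.  No definition is introduced: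
`a^±_t` are the displayed `sInf`/`sSup` expressions.

* `exists_alive_right`/`_left`, `exists_alive_right_lt`/`exists_alive_left_gt` — `R_t`, `L_t` are
  nonempty (far points are alive, `Loewner.lt_swallowingTime_of_far`) with no least/greatest
  element (the alive set is open);
* `exists_map_ofReal_re_eq_of_le` (`_left`) — intermediate values: every `v ≥ g_t(x₁)`, `x₁ ∈ R_t`,
  is `g_t(x)` for an alive `x ≥ x₁` (`g_t(x) ≥ x`, `Loewner.self_le_map_ofReal_re`);
* `driving_le_rightEnd`, `rightEnd_lt_map_ofReal_re`, `exists_map_ofReal_re_eq_of_rightEnd_lt`,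
  `exists_map_ofReal_re_lt_rightEnd_add` (and the left mirror images) — `W_t ≤ a⁺_t < g_t(x)` on
  `R_t`, `g_t(R_t) = (a⁺_t, ∞)`, and `a⁺_t` is approached;
* `eventually_rightEnd_lt`, `eventually_lt_leftEnd` — UPPER semicontinuity of `a⁺` and lower
  semicontinuity of `a⁻` in `(t, w) ∈ ℝ≥0 × C([0,∞), ℝ)` (kit I: an alive real point stays alive and
  its image moves continuously): a real interval off `[a⁻ - ε, a⁺ + ε]` of the limit stays off the
  image of the hull for all nearby `(t, w)` — the hypothesis under which kit IV applies along the
  whole interval.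

References: Lawler (2005) §4.1 (real points under the flow), Lemma 4.13; Kemppainen–Smirnov (2017)
App. A Lemma 5.4.
-/

noncomputable section

open Set Filter Topology Metric
open scoped NNReal
open Literature.Probability.RandomPlanarGeometry Literature.Probability.RandomPlanarGeometry.Loewner

namespace Summit.CriticalPhenomena.CardyFormulaZ2.Cruxes.CardyRigidity.CrossingMartingale

namespace LoewnerKit

variable {W : ℝ≥0 → ℝ}

/-! ### Alive real points: far points, up-rays, no end points -/

/-- **Far real points are alive**: there is `X` such that every real `x ≥ X` satisfies `W 0 < x`
and `t < T_x` (Lawler's Lemma 4.13, `Loewner.lt_swallowingTime_of_far`, with `M = max_{[0,t]} |W|`).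
[cite: Lawler2005, Lemma 4.13] -/
theorem exists_forall_ge_alive (hW : Continuous W) (t : ℝ≥0) :
    ∃ X : ℝ, ∀ x : ℝ, X ≤ x → W 0 < x ∧ (t : WithTop ℝ≥0) < swallowingTime W x := by
  -- a bound for `|W|` on `[0, t]`
  obtain ⟨s₀, -, hmax⟩ := isCompact_Icc.exists_isMaxOn (⟨0, left_mem_Icc.2 bot_le⟩ :
    (Icc (0 : ℝ≥0) t).Nonempty) (hW.abs.continuousOn (s := Icc 0 t))
  set M : ℝ := |W s₀| with hM
  have hMb : ∀ u ∈ Icc (0 : ℝ) t, ‖((W u.toNNReal : ℝ) : ℂ) - 0‖ ≤ M := by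
    intro u hu
    rw [sub_zero, Complex.norm_real, Real.norm_eq_abs]
    exact hmax (show u.toNNReal ∈ Icc (0 : ℝ≥0) t from
      ⟨bot_le, by rw [← NNReal.coe_le_coe, Real.coe_toNNReal u hu.1]; exact hu.2⟩)
  set δ : ℝ := 2 * Real.sqrt t + 1 with hδ
  have hδpos : 0 < δ := by positivity
  have hδt : 4 * (t : ℝ) ≤ δ ^ 2 := by
    have h1 : (Real.sqrt t) ^ 2 = t := Real.sq_sqrt t.coe_nonneg
    nlinarith [Real.sqrt_nonneg (t : ℝ)]
  have hM0 : |W 0| ≤ M := hmax (show (0 : ℝ≥0) ∈ Icc (0 : ℝ≥0) t from ⟨le_rfl, bot_le⟩)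
  refine ⟨M + 2 * δ, fun x hx ↦ ⟨?_, ?_⟩⟩
  · have : W 0 ≤ |W 0| := le_abs_self _
    linarith
  · have hfar : M + 2 * δ ≤ ‖(x : ℂ) - 0‖ := by
      rw [sub_zero, Complex.norm_real, Real.norm_eq_abs]
      exact hx.trans (le_abs_self x)
    exact (lt_swallowingTime_of_far hW hMb hδpos hδt hfar).1

/-- `R_t` is nonempty: some real point right of the driving point is alive at time `t`.
[cite: Lawler2005, Lemma 4.13] -/
theorem exists_alive_right (hW : Continuous W) (t : ℝ≥0) :
    ∃ x : ℝ, W 0 < x ∧ (t : WithTop ℝ≥0) < swallowingTime W x := by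
  obtain ⟨X, hX⟩ := exists_forall_ge_alive hW t
  exact ⟨X, hX X le_rfl⟩

/-- `R_t` is an up-ray: points right of an alive point right of the driving point are alive
(`Loewner.swallowingTime_mono_right`). [cite: Lawler2005, Ch. 4 §4.1] -/
theorem alive_right_of_le (hW : Continuous W) {t : ℝ≥0} {x x' : ℝ} (hx : W 0 < x)
    (ht : (t : WithTop ℝ≥0) < swallowingTime W x) (hxx' : x ≤ x') :
    (t : WithTop ℝ≥0) < swallowingTime W x' :=
  lt_of_lt_of_le ht (swallowingTime_mono_right hW hx hxx')

/-- `L_t` is a down-ray (`Loewner.swallowingTime_mono_left`). [cite: Lawler2005, Ch. 4 §4.1] -/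
theorem alive_left_of_le (hW : Continuous W) {t : ℝ≥0} {x x' : ℝ} (hx : x < W 0)
    (ht : (t : WithTop ℝ≥0) < swallowingTime W x) (hxx' : x' ≤ x) :
    (t : WithTop ℝ≥0) < swallowingTime W x' :=
  lt_of_lt_of_le ht (swallowingTime_mono_left hW hx hxx')

/-- `R_t` has no least element: left of an alive point right of the driving point there are
alive points right of the driving point (the alive set is open). [folklore] -/
theorem exists_alive_right_lt (hW : Continuous W) {t : ℝ≥0} {x : ℝ} (hx : W 0 < x)
    (ht : (t : WithTop ℝ≥0) < swallowingTime W x) :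
    ∃ x' : ℝ, W 0 < x' ∧ x' < x ∧ (t : WithTop ℝ≥0) < swallowingTime W x' := by
  obtain ⟨r, hr, hball⟩ := exists_closedBall_subset_alive hW ht
  set e : ℝ := min r ((x - W 0) / 2) with he
  have hepos : 0 < e := lt_min hr (by linarith)
  refine ⟨x - e, ?_, by linarith, hball _ ?_⟩
  · have : e ≤ (x - W 0) / 2 := min_le_right _ _
    linarith
  · rw [mem_closedBall, Complex.dist_eq, ← Complex.ofReal_sub, Complex.norm_real, Real.norm_eq_abs,
      show x - e - x = -e by ring, abs_neg, abs_of_pos hepos]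
    exact min_le_left _ _

/-- `L_t` has no greatest element. [folklore] -/
theorem exists_alive_left_gt (hW : Continuous W) {t : ℝ≥0} {x : ℝ} (hx : x < W 0)
    (ht : (t : WithTop ℝ≥0) < swallowingTime W x) :
    ∃ x' : ℝ, x' < W 0 ∧ x < x' ∧ (t : WithTop ℝ≥0) < swallowingTime W x' := by
  obtain ⟨r, hr, hball⟩ := exists_closedBall_subset_alive hW ht
  set e : ℝ := min r ((W 0 - x) / 2) with he
  have hepos : 0 < e := lt_min hr (by linarith)
  refine ⟨x + e, ?_, by linarith, hball _ ?_⟩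
  · have : e ≤ (W 0 - x) / 2 := min_le_right _ _
    linarith
  · rw [mem_closedBall, Complex.dist_eq, ← Complex.ofReal_sub, Complex.norm_real, Real.norm_eq_abs,
      show x + e - x = e by ring, abs_of_pos hepos]
    exact min_le_left _ _

/-- `L_t` is nonempty (reflection of `exists_alive_right`). [cite: Lawler2005, Lemma 4.13] -/
theorem exists_alive_left (hW : Continuous W) (t : ℝ≥0) :
    ∃ x : ℝ, x < W 0 ∧ (t : WithTop ℝ≥0) < swallowingTime W x := by
  obtain ⟨x, hx, ht⟩ := exists_alive_right (W := fun s ↦ -W s) hW.neg t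
  refine ⟨-x, by simpa using neg_lt_neg hx, ?_⟩
  rwa [← swallowingTime_neg_ofReal W (-x), neg_neg]

/-! ### `x ↦ g_t(x)` on the alive rays: continuity, growth, intermediate values -/

/-- `x ↦ re g_t(x)` is continuous at every alive real point. [folklore] -/
theorem continuousAt_map_ofReal_re (hW : Continuous W) {t : ℝ≥0} {x : ℝ}
    (ht : (t : WithTop ℝ≥0) < swallowingTime W x) :
    ContinuousAt (fun x : ℝ ↦ (map W t x).re) x :=
  (Complex.continuous_re.continuousAt.comp (continuousAt_map hW ht)).comp
    Complex.continuous_ofReal.continuousAt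

/-- Reflection: `re g^{-W}_t(-x) = -re g^{W}_t(x)` at an alive real point. [folklore] -/
theorem map_neg_ofReal_re (hW : Continuous W) {t : ℝ≥0} {x : ℝ}
    (ht : (t : WithTop ℝ≥0) < swallowingTime W x) :
    (map (fun s ↦ -W s) t ((-x : ℝ) : ℂ)).re = -(map W t x).re := by
  have h := realFlow_neg_driving hW ht
  simp only [realFlow] at h
  linarith

/-- `re g_t(x) ≤ x` for an alive `x < W 0` (reflection of `Loewner.self_le_map_ofReal_re`).
[cite: Lawler2005, Ch. 4 §4.1] -/
theorem map_ofReal_re_le_self (hW : Continuous W) {t : ℝ≥0} {x : ℝ} (hx : x < W 0)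
    (ht : (t : WithTop ℝ≥0) < swallowingTime W x) : (map W t x).re ≤ x := by
  have ht' : (t : WithTop ℝ≥0) < swallowingTime (fun s ↦ -W s) ((-x : ℝ) : ℂ) := by
    rwa [swallowingTime_neg_ofReal]
  have h := self_le_map_ofReal_re (W := fun s ↦ -W s) hW.neg (x := -x) (by simpa using neg_lt_neg hx) ht'
  rw [map_neg_ofReal_re hW ht] at h
  linarith

/-- **Intermediate values on the right ray**: for an alive `x₁ > W 0` and `v ≥ re g_t(x₁)` there
is an alive `x ≥ x₁` with `re g_t(x) = v` (`g_t` is continuous on `[x₁, ∞)`, all alive, with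
`re g_t(x) ≥ x`). [cite: Lawler2005, Ch. 4 §4.1] -/
theorem exists_map_ofReal_re_eq_of_le (hW : Continuous W) {t : ℝ≥0} {x₁ : ℝ} (hx₁ : W 0 < x₁)
    (ht : (t : WithTop ℝ≥0) < swallowingTime W x₁) {v : ℝ} (hv : (map W t x₁).re ≤ v) :
    ∃ x : ℝ, x₁ ≤ x ∧ (t : WithTop ℝ≥0) < swallowingTime W x ∧ (map W t x).re = v := by
  set x₂ : ℝ := max v x₁ with hx₂
  have h12 : x₁ ≤ x₂ := le_max_right _ _
  have halive : ∀ x ∈ Icc x₁ x₂, (t : WithTop ℝ≥0) < swallowingTime W x := fun x hx ↦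
    alive_right_of_le hW hx₁ ht hx.1
  have hcont : ContinuousOn (fun x : ℝ ↦ (map W t x).re) (Icc x₁ x₂) := fun x hx ↦
    (continuousAt_map_ofReal_re hW (halive x hx)).continuousWithinAt
  have hv₂ : v ≤ (map W t x₂).re := (le_max_left _ _).trans
    (self_le_map_ofReal_re hW (hx₁.trans_le h12) (halive x₂ ⟨h12, le_rfl⟩))
  obtain ⟨x, hx, hxv⟩ := intermediate_value_Icc h12 hcont ⟨hv, hv₂⟩
  exact ⟨x, hx.1, halive x hx, hxv⟩

/-- **Intermediate values on the left ray**: for an alive `y < W 0` and `v ≤ re g_t(y)` there is an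
alive `x ≤ y` with `re g_t(x) = v`. [cite: Lawler2005, Ch. 4 §4.1] -/
theorem exists_map_ofReal_re_eq_of_le_left (hW : Continuous W) {t : ℝ≥0} {y : ℝ} (hy : y < W 0)
    (ht : (t : WithTop ℝ≥0) < swallowingTime W y) {v : ℝ} (hv : v ≤ (map W t y).re) :
    ∃ x : ℝ, x ≤ y ∧ (t : WithTop ℝ≥0) < swallowingTime W x ∧ (map W t x).re = v := by
  set x₂ : ℝ := min v y with hx₂
  have h12 : x₂ ≤ y := min_le_right _ _
  have halive : ∀ x ∈ Icc x₂ y, (t : WithTop ℝ≥0) < swallowingTime W x := fun x hx ↦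
    alive_left_of_le hW hy ht hx.2
  have hcont : ContinuousOn (fun x : ℝ ↦ (map W t x).re) (Icc x₂ y) := fun x hx ↦
    (continuousAt_map_ofReal_re hW (halive x hx)).continuousWithinAt
  have hv₂ : (map W t x₂).re ≤ v :=
    (map_ofReal_re_le_self hW (h12.trans_lt hy) (halive x₂ ⟨le_rfl, h12⟩)).trans (min_le_left _ _)
  obtain ⟨x, hx, hxv⟩ := intermediate_value_Icc h12 hcont ⟨hv₂, hv⟩
  exact ⟨x, hx.2, halive x hx, hxv⟩

/-! ### The ends `a⁺_t = sInf g_t(R_t)` and `a⁻_t = sSup g_t(L_t)` of the image of the hull -/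

/-- `W_t ≤ a⁺_t`: every alive point right of the driving point has `re g_t(x) > W_t`
(`Loewner.driving_lt_map_ofReal_re`), and `R_t ≠ ∅`. [cite: Lawler2005, Ch. 4 §4.1] -/
theorem driving_le_rightEnd (hW : Continuous W) (t : ℝ≥0) :
    W t ≤ sInf ((fun x : ℝ ↦ (map W t x).re) ''
      {x : ℝ | W 0 < x ∧ (t : WithTop ℝ≥0) < swallowingTime W x}) := by
  obtain ⟨x, hx, ht⟩ := exists_alive_right hW t
  refine le_csInf ⟨(map W t x).re, x, ⟨hx, ht⟩, rfl⟩ ?_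
  rintro _ ⟨y, ⟨hy, hty⟩, rfl⟩
  exact (driving_lt_map_ofReal_re hW hy hty).le

/-- The image `g_t(R_t)` is bounded below (by `W_t`). [folklore] -/
theorem bddBelow_image_right (hW : Continuous W) (t : ℝ≥0) :
    BddBelow ((fun x : ℝ ↦ (map W t x).re) ''
      {x : ℝ | W 0 < x ∧ (t : WithTop ℝ≥0) < swallowingTime W x}) := by
  refine ⟨W t, ?_⟩
  rintro _ ⟨y, ⟨hy, hty⟩, rfl⟩
  exact (driving_lt_map_ofReal_re hW hy hty).le

/-- The image `g_t(R_t)` is nonempty. [folklore] -/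
theorem image_right_nonempty (hW : Continuous W) (t : ℝ≥0) :
    ((fun x : ℝ ↦ (map W t x).re) ''
      {x : ℝ | W 0 < x ∧ (t : WithTop ℝ≥0) < swallowingTime W x}).Nonempty := by
  obtain ⟨x, hx, ht⟩ := exists_alive_right hW t
  exact ⟨_, x, ⟨hx, ht⟩, rfl⟩

/-- **`a⁺_t < re g_t(x)` for every `x ∈ R_t`** (`R_t` has no least element and `g_t` is strictly
increasing on it). [cite: Lawler2005, Ch. 4 §4.1] -/
theorem rightEnd_lt_map_ofReal_re (hW : Continuous W) {t : ℝ≥0} {x : ℝ} (hx : W 0 < x)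
    (ht : (t : WithTop ℝ≥0) < swallowingTime W x) :
    sInf ((fun x : ℝ ↦ (map W t x).re) ''
      {x : ℝ | W 0 < x ∧ (t : WithTop ℝ≥0) < swallowingTime W x}) < (map W t x).re := by
  obtain ⟨x', hx', hx'x, ht'⟩ := exists_alive_right_lt hW hx ht
  calc sInf ((fun x : ℝ ↦ (map W t x).re) '' {x : ℝ | W 0 < x ∧ (t : WithTop ℝ≥0) < swallowingTime W x})
      ≤ (map W t x').re := csInf_le (bddBelow_image_right hW t) ⟨x', ⟨hx', ht'⟩, rfl⟩
    _ < (map W t x).re := map_ofReal_re_lt_of_lt hW hx' hx'x ht' ht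

/-- **`g_t(R_t) = (a⁺_t, ∞)`, surjectivity**: every real `v > a⁺_t` is `re g_t(x)` for an alive
`x > W 0`. [cite: Lawler2005, Ch. 4 §4.1] -/
theorem exists_map_ofReal_re_eq_of_rightEnd_lt (hW : Continuous W) {t : ℝ≥0} {v : ℝ}
    (hv : sInf ((fun x : ℝ ↦ (map W t x).re) ''
      {x : ℝ | W 0 < x ∧ (t : WithTop ℝ≥0) < swallowingTime W x}) < v) :
    ∃ x : ℝ, W 0 < x ∧ (t : WithTop ℝ≥0) < swallowingTime W x ∧ (map W t x).re = v := by
  obtain ⟨_, ⟨x', ⟨hx', ht'⟩, rfl⟩, hlt⟩ := exists_lt_of_csInf_lt (image_right_nonempty hW t) hv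
  obtain ⟨x, hxx, htx, hxv⟩ := exists_map_ofReal_re_eq_of_le hW hx' ht' hlt.le
  exact ⟨x, hx'.trans_le hxx, htx, hxv⟩

/-- `a⁺_t` is approached: for `ε > 0` some `x ∈ R_t` has `re g_t(x) < a⁺_t + ε`. [folklore] -/
theorem exists_map_ofReal_re_lt_rightEnd_add (hW : Continuous W) (t : ℝ≥0) {ε : ℝ} (hε : 0 < ε) :
    ∃ x : ℝ, W 0 < x ∧ (t : WithTop ℝ≥0) < swallowingTime W x ∧ (map W t x).re <
      sInf ((fun x : ℝ ↦ (map W t x).re) ''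
        {x : ℝ | W 0 < x ∧ (t : WithTop ℝ≥0) < swallowingTime W x}) + ε := by
  obtain ⟨_, ⟨x', ⟨hx', ht'⟩, rfl⟩, hlt⟩ :=
    exists_lt_of_csInf_lt (image_right_nonempty hW t) (lt_add_of_pos_right _ hε)
  exact ⟨x', hx', ht', hlt⟩

/-- `a⁻_t ≤ W_t` (`Loewner.map_ofReal_re_lt_driving`, `L_t ≠ ∅`). [cite: Lawler2005, Ch. 4 §4.1] -/
theorem leftEnd_le_driving (hW : Continuous W) (t : ℝ≥0) :
    sSup ((fun x : ℝ ↦ (map W t x).re) ''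
      {x : ℝ | x < W 0 ∧ (t : WithTop ℝ≥0) < swallowingTime W x}) ≤ W t := by
  obtain ⟨x, hx, ht⟩ := exists_alive_left hW t
  refine csSup_le ⟨(map W t x).re, x, ⟨hx, ht⟩, rfl⟩ ?_
  rintro _ ⟨y, ⟨hy, hty⟩, rfl⟩
  exact (map_ofReal_re_lt_driving hW hy hty).le

/-- The image `g_t(L_t)` is bounded above (by `W_t`). [folklore] -/
theorem bddAbove_image_left (hW : Continuous W) (t : ℝ≥0) :
    BddAbove ((fun x : ℝ ↦ (map W t x).re) ''
      {x : ℝ | x < W 0 ∧ (t : WithTop ℝ≥0) < swallowingTime W x}) := by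
  refine ⟨W t, ?_⟩
  rintro _ ⟨y, ⟨hy, hty⟩, rfl⟩
  exact (map_ofReal_re_lt_driving hW hy hty).le

/-- The image `g_t(L_t)` is nonempty. [folklore] -/
theorem image_left_nonempty (hW : Continuous W) (t : ℝ≥0) :
    ((fun x : ℝ ↦ (map W t x).re) ''
      {x : ℝ | x < W 0 ∧ (t : WithTop ℝ≥0) < swallowingTime W x}).Nonempty := by
  obtain ⟨x, hx, ht⟩ := exists_alive_left hW t
  exact ⟨_, x, ⟨hx, ht⟩, rfl⟩

/-- **`re g_t(x) < a⁻_t` for every `x ∈ L_t`.** [cite: Lawler2005, Ch. 4 §4.1] -/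
theorem map_ofReal_re_lt_leftEnd (hW : Continuous W) {t : ℝ≥0} {x : ℝ} (hx : x < W 0)
    (ht : (t : WithTop ℝ≥0) < swallowingTime W x) :
    (map W t x).re < sSup ((fun x : ℝ ↦ (map W t x).re) ''
      {x : ℝ | x < W 0 ∧ (t : WithTop ℝ≥0) < swallowingTime W x}) := by
  obtain ⟨x', hx', hxx', ht'⟩ := exists_alive_left_gt hW hx ht
  calc (map W t x).re < (map W t x').re := map_ofReal_re_lt_of_lt_of_neg hW hx' hxx' ht ht'
    _ ≤ _ := le_csSup (bddAbove_image_left hW t) ⟨x', ⟨hx', ht'⟩, rfl⟩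

/-- **`g_t(L_t) = (-∞, a⁻_t)`, surjectivity**: every real `v < a⁻_t` is `re g_t(x)` for an alive
`x < W 0`. [cite: Lawler2005, Ch. 4 §4.1] -/
theorem exists_map_ofReal_re_eq_of_lt_leftEnd (hW : Continuous W) {t : ℝ≥0} {v : ℝ}
    (hv : v < sSup ((fun x : ℝ ↦ (map W t x).re) ''
      {x : ℝ | x < W 0 ∧ (t : WithTop ℝ≥0) < swallowingTime W x})) :
    ∃ x : ℝ, x < W 0 ∧ (t : WithTop ℝ≥0) < swallowingTime W x ∧ (map W t x).re = v := by
  obtain ⟨_, ⟨x', ⟨hx', ht'⟩, rfl⟩, hlt⟩ := exists_lt_of_lt_csSup (image_left_nonempty hW t) hv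
  obtain ⟨x, hxx, htx, hxv⟩ := exists_map_ofReal_re_eq_of_le_left hW hx' ht' hlt.le
  exact ⟨x, hxx.trans_lt hx', htx, hxv⟩

/-- `a⁻_t` is approached: for `ε > 0` some `x ∈ L_t` has `a⁻_t - ε < re g_t(x)`. [folklore] -/
theorem exists_leftEnd_sub_lt_map_ofReal_re (hW : Continuous W) (t : ℝ≥0) {ε : ℝ} (hε : 0 < ε) :
    ∃ x : ℝ, x < W 0 ∧ (t : WithTop ℝ≥0) < swallowingTime W x ∧
      sSup ((fun x : ℝ ↦ (map W t x).re) ''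
        {x : ℝ | x < W 0 ∧ (t : WithTop ℝ≥0) < swallowingTime W x}) - ε < (map W t x).re := by
  obtain ⟨_, ⟨x', ⟨hx', ht'⟩, rfl⟩, hlt⟩ :=
    exists_lt_of_lt_csSup (image_left_nonempty hW t) (sub_lt_self _ hε)
  exact ⟨x', hx', ht', hlt⟩

/-! ### Semicontinuity of the ends in time and driving path -/

/-- The image of a fixed alive real point moves continuously in `(t, w)`, and the point stays
alive and on the same side of the driving point (kit I on `K = {x}`). [cite: KemppainenSmirnov2017, App. A, Lemma 5.4] -/
theorem eventually_alive_and_dist_map_lt (q₀ : ℝ≥0 × C(ℝ≥0, ℝ)) {x : ℝ}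
    (ht : (q₀.1 : WithTop ℝ≥0) < swallowingTime q₀.2 x) {ε : ℝ} (hε : 0 < ε) :
    ∀ᶠ q : ℝ≥0 × C(ℝ≥0, ℝ) in 𝓝 q₀, (q.1 : WithTop ℝ≥0) < swallowingTime q.2 x ∧
      |(map q.2 q.1 x).re - (map q₀.2 q₀.1 x).re| < ε ∧ |q.2 0 - q₀.2 0| < ε := by
  obtain ⟨halive, hconv⟩ := tendstoUniformlyOn_map_nhds q₀ (isCompact_singleton (x := (x : ℂ)))
    (fun z hz ↦ by rw [mem_singleton_iff.1 hz]; exact ht)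
  have h2 := (Metric.tendstoUniformlyOn_iff.1 hconv) ε hε
  have h3 : ∀ᶠ q : ℝ≥0 × C(ℝ≥0, ℝ) in 𝓝 q₀, dist (q.2 0) (q₀.2 0) < ε := by
    have hc : Continuous fun q : ℝ≥0 × C(ℝ≥0, ℝ) ↦ q.2 0 :=
      (continuous_eval_const (F := C(ℝ≥0, ℝ)) (0 : ℝ≥0)).comp continuous_snd
    exact (hc.tendsto q₀).eventually (ball_mem_nhds _ hε)
  filter_upwards [halive, h2, h3] with q hq hq' hq''
  refine ⟨hq _ (mem_singleton _), ?_, by rwa [← Real.dist_eq]⟩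
  have h := hq' _ (mem_singleton _)
  rw [dist_comm, dist_eq_norm] at h
  have hre := Complex.abs_re_le_norm (map q.2 q.1 x - map q₀.2 q₀.1 x)
  rw [Complex.sub_re] at hre
  exact lt_of_le_of_lt hre h

/-- **Upper semicontinuity of the right end `a⁺` in `(t, w)`**: for `ε > 0`, for all `(t, w)`
near `(t₀, w₀)` in `ℝ≥0 × C([0,∞), ℝ)`, `a⁺(t, w) < a⁺(t₀, w₀) + ε` (an alive point `x₁` of the
limit with `re g(x₁) < a⁺ + ε/2` stays alive, right of the driving point, with image within
`ε/2`). Consequently a real interval right of `a⁺(t₀, w₀) + ε` stays off the image of the hull.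
[cite: KemppainenSmirnov2017, App. A, Lemma 5.4] -/
theorem eventually_rightEnd_lt (q₀ : ℝ≥0 × C(ℝ≥0, ℝ)) {ε : ℝ} (hε : 0 < ε) :
    ∀ᶠ q : ℝ≥0 × C(ℝ≥0, ℝ) in 𝓝 q₀,
      sInf ((fun x : ℝ ↦ (map q.2 q.1 x).re) ''
          {x : ℝ | q.2 0 < x ∧ (q.1 : WithTop ℝ≥0) < swallowingTime q.2 x}) <
        sInf ((fun x : ℝ ↦ (map q₀.2 q₀.1 x).re) ''
          {x : ℝ | q₀.2 0 < x ∧ (q₀.1 : WithTop ℝ≥0) < swallowingTime q₀.2 x}) + ε := by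
  obtain ⟨x₁, hx₁, ht₁, hlt⟩ :=
    exists_map_ofReal_re_lt_rightEnd_add q₀.2.continuous q₀.1 (half_pos hε)
  have hm : 0 < min (ε / 2) (x₁ - q₀.2 0) := lt_min (half_pos hε) (by linarith)
  filter_upwards [eventually_alive_and_dist_map_lt q₀ ht₁ hm] with q hq
  obtain ⟨hqa, hqd, hq0⟩ := hq
  have hqx : q.2 0 < x₁ := by
    have := (abs_sub_lt_iff.1 (hq0.trans_le (min_le_right _ _))).1
    linarith
  have hre : (map q.2 q.1 x₁).re < (map q₀.2 q₀.1 x₁).re + ε / 2 := by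
    have := (abs_sub_lt_iff.1 (hqd.trans_le (min_le_left _ _))).1
    linarith
  calc _ < (map q.2 q.1 x₁).re := rightEnd_lt_map_ofReal_re q.2.continuous hqx hqa
    _ < _ := by linarith

/-- **Lower semicontinuity of the left end `a⁻` in `(t, w)`**: for `ε > 0`, for all `(t, w)` near
`(t₀, w₀)`, `a⁻(t₀, w₀) - ε < a⁻(t, w)`. [cite: KemppainenSmirnov2017, App. A, Lemma 5.4] -/
theorem eventually_lt_leftEnd (q₀ : ℝ≥0 × C(ℝ≥0, ℝ)) {ε : ℝ} (hε : 0 < ε) :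
    ∀ᶠ q : ℝ≥0 × C(ℝ≥0, ℝ) in 𝓝 q₀,
      sSup ((fun x : ℝ ↦ (map q₀.2 q₀.1 x).re) ''
          {x : ℝ | x < q₀.2 0 ∧ (q₀.1 : WithTop ℝ≥0) < swallowingTime q₀.2 x}) - ε <
        sSup ((fun x : ℝ ↦ (map q.2 q.1 x).re) ''
          {x : ℝ | x < q.2 0 ∧ (q.1 : WithTop ℝ≥0) < swallowingTime q.2 x}) := by
  obtain ⟨x₁, hx₁, ht₁, hlt⟩ :=
    exists_leftEnd_sub_lt_map_ofReal_re q₀.2.continuous q₀.1 (half_pos hε)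
  have hm : 0 < min (ε / 2) (q₀.2 0 - x₁) := lt_min (half_pos hε) (by linarith)
  filter_upwards [eventually_alive_and_dist_map_lt q₀ ht₁ hm] with q hq
  obtain ⟨hqa, hqd, hq0⟩ := hq
  have hqx : x₁ < q.2 0 := by
    have := (abs_sub_lt_iff.1 (hq0.trans_le (min_le_right _ _))).2
    linarith
  have hre : (map q₀.2 q₀.1 x₁).re - ε / 2 < (map q.2 q.1 x₁).re := by
    have := (abs_sub_lt_iff.1 (hqd.trans_le (min_le_left _ _))).2
    linarith
  calc _ < (map q.2 q.1 x₁).re := by linarith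
    _ < _ := map_ofReal_re_lt_leftEnd q.2.continuous hqx hqa

end LoewnerKit

/-- **Registered form** (anchor `loewnerKit_eventually_rightEnd_lt` of stmt-CriticalPhenomena-0746): upper semicontinuity
in `(t, w)` of the right end `a⁺(t, w) = sInf g^{w}_t(R_t(w))` of the image of the hull on the real line.
[cite: KemppainenSmirnov2017, App. A, Lemma 5.4] -/
theorem loewnerKit_eventually_rightEnd_lt : ∀ (q₀ : NNReal × ContinuousMap NNReal ℝ) {ε : ℝ}, 0 < ε → ∀ᶠ q : NNReal × ContinuousMap NNReal ℝ in nhds q₀, sInf ((fun x : ℝ ↦ (Literature.Probability.RandomPlanarGeometry.Loewner.map (⇑q.2) q.1 (x : ℂ)).re) '' {x : ℝ | q.2 0 < x ∧ (q.1 : WithTop NNReal) < Literature.Probability.RandomPlanarGeometry.Loewner.swallowingTime (⇑q.2) (x : ℂ)}) < sInf ((fun x : ℝ ↦ (Literature.Probability.RandomPlanarGeometry.Loewner.map (⇑q₀.2) q₀.1 (x : ℂ)).re) '' {x : ℝ | q₀.2 0 < x ∧ (q₀.1 : WithTop NNReal) < Literature.Probability.RandomPlanarGeometry.Loewner.swallowingTime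 (⇑q₀.2) (x : ℂ)}) + ε :=
  fun q₀ _ hε ↦ LoewnerKit.eventually_rightEnd_lt q₀ hε

end Summit.CriticalPhenomena.CardyFormulaZ2.Cruxes.CardyRigidity.CrossingMartingale

end
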